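import Literature.NumberTheory.Sieve.LargestPrimeFactorCubicEulerIdentity
import Mathlib.NumberTheory.EulerProduct.Basic
import HarnessLib

/-!
# Heath-Brown 2001 (PLMS), p. 11: the series `∑_d l(d)ν(d)/d` of Lemma 7 — multiplicativity,
# absolute convergence, Euler product `= lim ∏_{p<N} c(p) = P/(2 Rinf)`

Topic `Literature/NumberTheory/Sieve`; a PROVED layer (definitions with bodies, no named facts) under
the named fact `Irving2015_largestPrimeFactor_cubic` (`LargestPrimeFactorCubic.lean`), continuing
`…EulerIdentity` (the Euler factors `c(p) = 1 + l(p)ν(p)/p + l(p²)ν(p²)/p²` and `∏_{p<N} c(p) →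
P/(2 Rinf)`).  Source: D. R. Heath-Brown, *The largest prime factor of `X³ + 2`*, Proc. London Math.
Soc. (3) 82 (2001) 554–596: the multiplicative functions `l`, `ν` of (2.18)–(2.19) and p. 11, the
constant `C₁ = (6/π²) ∑_{d=1}^∞ l(d)ν(d)/d` of Lemma 7 (p. 11), and in its proof (p. 29) "the infinite
sum is absolutely convergent" with the tail estimate
"`∑_{d ≥ N^δ} l(d)ν(d)/d ≪ ∑_{ef² ≥ N^δ} (ef)^{−2+ε} ≪ N^{−δ/2+ε}`".

PROVED here: `lFun`, `nuFun`, `invNat` (arithmetic functions `l`, `ν`, `1/d`), their multiplicativity,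
`lnu = l·ν/id` and its values at prime powers (`lnu_prime`, `lnu_prime_sq`, `lnu_prime_pow_eq_zero`),
`tsum_lnu_prime_pow` (`∑_e lnu(p^e) = c(p)`), the bounds `|lnu(p)| ≤ 15/p²`, `|lnu(p²)| ≤ 6/p²`
(`p ≥ 5`), **`summable_abs_lnu`** (absolute convergence, through the smooth-number Euler products of
Mathlib), and **`tsum_lnu_eq`**: `∑_d l(d)ν(d)/d = P/(2 Rinf)` with `P = lim ∏_{5≤p≤N} k(p)` — i.e.
Heath-Brown's "`C₂C₃ = (log 2)(log 4/3)/(3π²) ∏ k(p)`" at the level of `C₁`.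

## References

* D. R. Heath-Brown, *The largest prime factor of `X³ + 2`*, Proc. London Math. Soc. (3) 82 (2001)
  554–596: (2.18)–(2.19) p. 10, p. 11 (ν, C₁), p. 29 (absolute convergence).
  [`HeathBrown2001LargestPrimeFactorCubic`]

## Mathlib / tree search

Tree: `lOne`, `lTwo`, `nuP`, `cFactor`, `cProd`, `tendsto_cProd` (`…EulerIdentity`),
`CubicPrimes.cubeRootTwoCount`.  Mathlib: `ArithmeticFunction.IsMultiplicative.pmul`,
`ArithmeticFunction.prodPrimeFactors`, `EulerProduct.eulerProduct`,
`EulerProduct.summable_and_hasSum_smoothNumbers_prod_primesBelow_tsum`, `summable_of_sum_range_le`,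
`tendsto_nhds_unique`.
-/

noncomputable section

open Finset Filter Topology ArithmeticFunction

namespace Literature.NumberTheory.Sieve.HeathBrown2001

open CubicPrimes (cubeRootTwoCount)

/-! ### The arithmetic functions `l`, `ν`, `1/d` -/

/-- `l` at a prime power: `l(p) = lOne p`, `l(p²) = lTwo p`, `l(p^e) = 0` for `e ≥ 3` (and `e = 0 ↦ 1`).
[cite: HeathBrown2001LargestPrimeFactorCubic, (2.18)–(2.19)] -/
def lpp (p e : ℕ) : ℝ := if e = 0 then 1 else if e = 1 then lOne p else if e = 2 then lTwo p else 0

/-- Heath-Brown's multiplicative function `l(d) = ∏_{p^e ∥ d} l(p^e)`.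
[cite: HeathBrown2001LargestPrimeFactorCubic, (2.18)–(2.19)] -/
def lFun : ArithmeticFunction ℝ :=
  ⟨fun d => if d = 0 then 0 else ∏ p ∈ d.primeFactors, lpp p (d.factorization p), by simp⟩

/-- `lFun d` for `d ≠ 0`. [folklore] -/
theorem lFun_apply {d : ℕ} (hd : d ≠ 0) : lFun d = ∏ p ∈ d.primeFactors, lpp p (d.factorization p) := by
  rw [lFun]; simp [hd]

/-- Off the support: `n.factorization p = 0` for `p ∉ n.primeFactors`. [folklore] -/
theorem factorization_eq_zero_of_not_mem {n p : ℕ} (h : p ∉ n.primeFactors) : n.factorization p = 0 :=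
  Finsupp.notMem_support_iff.mp (by rwa [Nat.support_factorization])

/-- `l` is multiplicative. [cite: HeathBrown2001LargestPrimeFactorCubic, (2.18) ("the multiplicative function l(d)")] -/
theorem isMultiplicative_lFun : lFun.IsMultiplicative := by
  refine ⟨by rw [lFun_apply one_ne_zero]; simp, fun {m n} hmn => ?_⟩
  rcases eq_or_ne m 0 with rfl | hm
  · simp [lFun]
  rcases eq_or_ne n 0 with rfl | hn
  · simp [lFun]
  have hdisj := hmn.disjoint_primeFactors
  rw [lFun_apply (mul_ne_zero hm hn), lFun_apply hm, lFun_apply hn, Nat.primeFactors_mul hm hn,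
    prod_union hdisj]
  congr 1
  · refine prod_congr rfl fun p hp => ?_
    rw [Nat.factorization_mul hm hn, Finsupp.add_apply,
      factorization_eq_zero_of_not_mem (Finset.disjoint_left.mp hdisj hp), add_zero]
  · refine prod_congr rfl fun p hp => ?_
    rw [Nat.factorization_mul hm hn, Finsupp.add_apply,
      factorization_eq_zero_of_not_mem (Finset.disjoint_right.mp hdisj hp), zero_add]

/-- `l` at a prime power. [folklore] -/
theorem lFun_prime_pow {p : ℕ} (hp : p.Prime) {e : ℕ} (he : e ≠ 0) : lFun (p ^ e) = lpp p e := by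
  rw [lFun_apply (pow_ne_zero _ hp.ne_zero), Nat.primeFactors_prime_pow he hp, prod_singleton,
    hp.factorization_pow, Finsupp.single_eq_same]

/-- Heath-Brown's `ν(d) = ∏_{p ∣ d} p g(p)/(p + 1)` (`ν(p^e) = g(p)/(1 + p⁻¹)` for `e ≥ 1`).
[cite: HeathBrown2001LargestPrimeFactorCubic, p. 11 (ν)] -/
def nuFun : ArithmeticFunction ℝ := prodPrimeFactors fun p => nuP p

/-- `ν` is multiplicative. [folklore] -/
theorem isMultiplicative_nuFun : nuFun.IsMultiplicative := IsMultiplicative.prodPrimeFactors _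

/-- `ν(p^e) = nuP p` for `e ≥ 1`. [folklore] -/
theorem nuFun_prime_pow {p : ℕ} (hp : p.Prime) {e : ℕ} (he : e ≠ 0) : nuFun (p ^ e) = nuP p := by
  rw [nuFun, prodPrimeFactors_apply (pow_ne_zero _ hp.ne_zero), Nat.primeFactors_prime_pow he hp,
    prod_singleton]

/-- The completely multiplicative function `d ↦ 1/d`. [folklore] -/
def invNat : ArithmeticFunction ℝ := ⟨fun d => (d : ℝ)⁻¹, by simp⟩

/-- `invNat d = 1/d`. [folklore] -/
theorem invNat_apply (d : ℕ) : invNat d = (d : ℝ)⁻¹ := rfl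

/-- `1/d` is multiplicative. [folklore] -/
theorem isMultiplicative_invNat : invNat.IsMultiplicative :=
  ⟨by simp [invNat_apply], fun {m n} _ => by simp [invNat_apply, mul_comm]⟩

/-- **`lnu(d) = l(d)ν(d)/d`**, the summand of `C₁ = (6/π²)∑_d l(d)ν(d)/d`.
[cite: HeathBrown2001LargestPrimeFactorCubic, p. 11 (C₁)] -/
def lnu : ArithmeticFunction ℝ := lFun.pmul (nuFun.pmul invNat)

/-- `lnu` is multiplicative. [folklore] -/
theorem isMultiplicative_lnu : lnu.IsMultiplicative :=
  isMultiplicative_lFun.pmul (isMultiplicative_nuFun.pmul isMultiplicative_invNat)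

/-- `lnu d = l(d) ν(d) / d`. [folklore] -/
theorem lnu_apply (d : ℕ) : lnu d = lFun d * nuFun d / d := by
  rw [lnu, pmul_apply, pmul_apply, invNat_apply, div_eq_mul_inv, mul_assoc]

/-- `lnu(p) = l(p)ν(p)/p`. [folklore] -/
theorem lnu_prime {p : ℕ} (hp : p.Prime) : lnu p = lOne p * nuP p / p := by
  have := lnu_apply p
  rw [show (p : ℕ) = p ^ 1 from (pow_one p).symm, lFun_prime_pow hp one_ne_zero,
    nuFun_prime_pow hp one_ne_zero, pow_one] at this
  rw [this, lpp]; simp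

/-- `lnu(p²) = l(p²)ν(p²)/p²`. [folklore] -/
theorem lnu_prime_sq {p : ℕ} (hp : p.Prime) : lnu (p ^ 2) = lTwo p * nuP p / (p : ℝ) ^ 2 := by
  rw [lnu_apply, lFun_prime_pow hp two_ne_zero, nuFun_prime_pow hp two_ne_zero, lpp]
  push_cast; simp

/-- `lnu(p^e) = 0` for `e ≥ 3`. [cite: HeathBrown2001LargestPrimeFactorCubic, (2.18) ("l(p^e) = 0 (e ≥ 3)")] -/
theorem lnu_prime_pow_eq_zero {p : ℕ} (hp : p.Prime) {e : ℕ} (he : 3 ≤ e) : lnu (p ^ e) = 0 := by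
  rw [lnu_apply, lFun_prime_pow hp (by omega), lpp, if_neg (by omega), if_neg (by omega), if_neg (by omega)]
  simp

/-- `lnu 1 = 1`, `lnu 0 = 0`. [folklore] -/
theorem lnu_one : lnu 1 = 1 := isMultiplicative_lnu.map_one

/-- **`∑_e lnu(p^e) = c(p)`**: the Euler factor of `∑_d l(d)ν(d)/d` at `p`.
[cite: HeathBrown2001LargestPrimeFactorCubic, p. 11] -/
theorem tsum_lnu_prime_pow {p : ℕ} (hp : p.Prime) : ∑' e : ℕ, lnu (p ^ e) = cFactor p := by
  rw [tsum_eq_sum (s := Finset.range 3) (fun e he => ?_)]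
  · rw [Finset.sum_range_succ, Finset.sum_range_succ, Finset.sum_range_one, pow_zero, lnu_one, pow_one,
      lnu_prime hp, lnu_prime_sq hp, cFactor]
  · rw [Finset.mem_range, not_lt] at he
    exact lnu_prime_pow_eq_zero hp he

/-! ### Bounds at prime powers -/

/-- For `p ≥ 5`: `|lnu(p)| ≤ 15/p²` and `|lnu(p²)| ≤ 6/p²` (`|g − 2| ≤ 2`, `p − g ≥ p − 3`, `ν(p)/p ≤ 3/p`).
[cite: HeathBrown2001LargestPrimeFactorCubic, p. 29 ("≪ (ef)^{-2+ε}")] -/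
theorem abs_lnu_prime_le {p : ℕ} (hp : p.Prime) (h5 : 5 ≤ p) :
    |lnu p| ≤ 15 / (p : ℝ) ^ 2 ∧ |lnu (p ^ 2)| ≤ 6 / (p : ℝ) ^ 2 := by
  have hp5 : (5 : ℝ) ≤ p := by exact_mod_cast h5
  have hp3 : p ≠ 3 := by omega
  have hg : (cubeRootTwoCount p : ℝ) = 0 ∨ (cubeRootTwoCount p : ℝ) = 1 ∨ (cubeRootTwoCount p : ℝ) = 3 := by
    rcases cubeRootTwoCount_mem hp h5 with h | h | h <;> simp [h]
  set g : ℝ := (cubeRootTwoCount p : ℝ) with hgdef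
  have hg0 : 0 ≤ g := by rcases hg with h | h | h <;> linarith
  have hg3 : g ≤ 3 := by rcases hg with h | h | h <;> linarith
  have habs : |g - 2| ≤ 2 := by rw [abs_le]; constructor <;> linarith
  have hpg : 0 < (p : ℝ) - g := by linarith
  have hp0 : (0 : ℝ) < p := by linarith
  have hden : 0 < ((p : ℝ) - g) * (p + 1) := by positivity
  have e1 : lnu p = (g - 2) * g / (((p : ℝ) - g) * (p + 1)) := by
    rw [lnu_prime hp, lOne, nuP, if_neg hp3, ← hgdef]; field_simp
  have e2 : lnu (p ^ 2) = -(((p : ℝ) - 2) * g) / (((p : ℝ) - g) * (p + 1) * p) := by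
    rw [lnu_prime_sq hp, lTwo, nuP, if_neg hp3, ← hgdef]; field_simp
  constructor
  · rw [e1, abs_div, abs_of_pos hden, abs_mul, abs_of_nonneg hg0, div_le_div_iff₀ hden (by positivity)]
    have h1 : |g - 2| * g ≤ 6 := by nlinarith [mul_le_mul_of_nonneg_right habs hg0]
    have h2 : (p : ℝ) ^ 2 ≤ 5 / 2 * (((p : ℝ) - g) * (p + 1)) := by nlinarith
    have h3 : 0 ≤ |g - 2| * g := by positivity
    nlinarith [mul_le_mul h1 h2 (by positivity) (by norm_num)]
  · rw [e2, abs_div, abs_neg, abs_of_pos (by positivity : 0 < ((p : ℝ) - g) * (p + 1) * p), abs_mul,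
      abs_of_nonneg (by linarith : (0 : ℝ) ≤ p - 2), abs_of_nonneg hg0,
      div_le_div_iff₀ (by positivity) (by positivity)]
    have ha : ((p : ℝ) - 2) ≤ 3 / 2 * ((p : ℝ) - g) := by nlinarith
    have hb : g * (p : ℝ) ^ 2 ≤ 4 * (((p : ℝ) + 1) * p) := by nlinarith
    have := mul_le_mul ha hb (by positivity) (by positivity)
    nlinarith [this]

/-- At `p = 2, 3`: `|lnu(p)| ≤ 1`, `lnu(p²) = 0`. [folklore] -/
theorem abs_lnu_two_three :
    |lnu 2| ≤ 1 ∧ lnu (2 ^ 2) = 0 ∧ |lnu 3| ≤ 1 ∧ lnu (3 ^ 2) = 0 := by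
  rw [lnu_prime Nat.prime_two, lnu_prime_sq Nat.prime_two, lnu_prime Nat.prime_three,
    lnu_prime_sq Nat.prime_three, lOne, lOne, lTwo, lTwo, nuP, nuP, CubicPrimes.cubeRootTwoCount_two,
    CubicPrimes.cubeRootTwoCount_three]
  norm_num [abs_le]

/-- The local terms `a_p = |lnu(p)| + |lnu(p²)|` have `∑_{p < N} a_p ≤ 8`. [folklore] -/
theorem sum_primesBelow_abs_lnu_le (N : ℕ) :
    ∑ p ∈ Nat.primesBelow N, (|lnu p| + |lnu (p ^ 2)|) ≤ 8 := by
  classical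
  -- split the primes `< 5` from the rest
  have hsplit := Finset.sum_filter_add_sum_filter_not (Nat.primesBelow N) (fun p => p < 5)
    (fun p => |lnu p| + |lnu (p ^ 2)|)
  rw [← hsplit]
  have h1 : ∑ p ∈ (Nat.primesBelow N).filter (fun p => p < 5), (|lnu p| + |lnu (p ^ 2)|) ≤ 2 := by
    have hsub : (Nat.primesBelow N).filter (fun p => p < 5) ⊆ {2, 3} := by
      intro p hp
      rw [Finset.mem_filter, Nat.mem_primesBelow] at hp
      obtain ⟨⟨-, hpP⟩, hp5⟩ := hp
      have := hpP.two_le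
      interval_cases p
      · simp
      · simp
      · exact absurd hpP (by decide)
    obtain ⟨h2, h4, h3, h9⟩ := abs_lnu_two_three
    calc ∑ p ∈ (Nat.primesBelow N).filter (fun p => p < 5), (|lnu p| + |lnu (p ^ 2)|)
        ≤ ∑ p ∈ ({2, 3} : Finset ℕ), (|lnu p| + |lnu (p ^ 2)|) :=
          Finset.sum_le_sum_of_subset_of_nonneg hsub fun p _ _ => by positivity
      _ ≤ 2 := by
          rw [Finset.sum_pair (by norm_num), h4, h9, abs_zero, add_zero, add_zero]; linarith
  have h2 : ∑ p ∈ (Nat.primesBelow N).filter (fun p => ¬ p < 5), (|lnu p| + |lnu (p ^ 2)|) ≤ 21 / 4 := by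
    calc ∑ p ∈ (Nat.primesBelow N).filter (fun p => ¬ p < 5), (|lnu p| + |lnu (p ^ 2)|)
        ≤ ∑ p ∈ (Nat.primesBelow N).filter (fun p => ¬ p < 5), 21 * (1 / (p : ℝ) ^ 2) := by
          refine Finset.sum_le_sum fun p hp => ?_
          rw [Finset.mem_filter, Nat.mem_primesBelow, not_lt] at hp
          obtain ⟨ha, hb⟩ := abs_lnu_prime_le hp.1.2 hp.2
          have : (0 : ℝ) < (p : ℝ) ^ 2 := by have := hp.1.2.pos; positivity
          rw [div_eq_mul_one_div 15, div_eq_mul_one_div 6] at *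
          linarith
      _ = 21 * ∑ p ∈ (Nat.primesBelow N).filter (fun p => ¬ p < 5), 1 / (p : ℝ) ^ 2 := by rw [Finset.mul_sum]
      _ ≤ 21 * (1 / 4) := by
          gcongr
          have hsub : (Nat.primesBelow N).filter (fun p => ¬ p < 5) ⊆ Finset.Ioc 4 N := by
            intro p hp
            rw [Finset.mem_filter, Nat.mem_primesBelow, not_lt] at hp
            rw [Finset.mem_Ioc]; omega
          calc ∑ p ∈ (Nat.primesBelow N).filter (fun p => ¬ p < 5), 1 / (p : ℝ) ^ 2
              ≤ ∑ n ∈ Finset.Ioc 4 N, 1 / (n : ℝ) ^ 2 :=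
                Finset.sum_le_sum_of_subset_of_nonneg hsub fun n _ _ => by positivity
            _ ≤ 1 / 4 := by have := sum_Ioc_inv_sq_le (by norm_num : 1 ≤ 4) N; norm_num at this ⊢; exact this
      _ = 21 / 4 := by norm_num
  linarith

/-! ### Absolute convergence -/

/-- The local Euler factor of `|lnu|`: `∑_e |lnu(p^e)| = 1 + |lnu(p)| + |lnu(p²)|`. [folklore] -/
theorem tsum_abs_lnu_prime_pow {p : ℕ} (hp : p.Prime) :
    ∑' e : ℕ, |lnu (p ^ e)| = 1 + |lnu p| + |lnu (p ^ 2)| := by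
  rw [tsum_eq_sum (s := Finset.range 3) (fun e he => ?_)]
  · rw [Finset.sum_range_succ, Finset.sum_range_succ, Finset.sum_range_one, pow_zero, lnu_one, pow_one,
      abs_one]
  · rw [Finset.mem_range, not_lt] at he
    rw [lnu_prime_pow_eq_zero hp he, abs_zero]

/-- Partial sums of `|lnu|` are bounded: `∑_{d<N} |lnu(d)| ≤ e⁸`. [cite: HeathBrown2001LargestPrimeFactorCubic, p. 29 ("absolutely convergent")] -/
theorem sum_range_abs_lnu_le (N : ℕ) : ∑ d ∈ Finset.range N, |lnu d| ≤ Real.exp 8 := by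
  classical
  -- the Euler product over `N`-smooth numbers for `|lnu|`
  have hmul : ∀ {m n : ℕ}, Nat.Coprime m n → |lnu (m * n)| = |lnu m| * |lnu n| := by
    intro m n hmn; rw [isMultiplicative_lnu.map_mul_of_coprime hmn, abs_mul]
  have hloc : ∀ {p : ℕ}, p.Prime → Summable (fun e : ℕ => ‖|lnu (p ^ e)|‖) := by
    intro p hp
    refine summable_of_ne_finset_zero (s := Finset.range 3) fun e he => ?_
    rw [Finset.mem_range, not_lt] at he
    rw [lnu_prime_pow_eq_zero hp he]; simp
  have h := (EulerProduct.summable_and_hasSum_smoothNumbers_prod_primesBelow_tsum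
    (f := fun d : ℕ => |lnu d|) (by rw [lnu_one, abs_one]) hmul hloc N).2
  have h' : HasSum ((fun d : ℕ => |lnu d|) ∘ (Subtype.val : N.smoothNumbers → ℕ))
      (∏ p ∈ N.primesBelow, ∑' e : ℕ, |lnu (p ^ e)|) := h
  rw [hasSum_subtype_iff_indicator] at h'
  -- the finite sum is dominated by the smooth sum
  have hle : ∑ d ∈ Finset.range N, |lnu d| ≤ ∏ p ∈ N.primesBelow, ∑' e : ℕ, |lnu (p ^ e)| := by
    have heq : ∑ d ∈ Finset.range N, |lnu d| =
        ∑ d ∈ Finset.range N, (N.smoothNumbers).indicator (fun d : ℕ => |lnu d|) d := by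
      refine Finset.sum_congr rfl fun d hd => ?_
      rw [Finset.mem_range] at hd
      rcases Nat.eq_zero_or_pos d with rfl | hd0
      · simp [Set.indicator_apply]
      · rw [Set.indicator_of_mem (Nat.mem_smoothNumbers_of_lt hd0 hd)]
    rw [heq]
    exact sum_le_hasSum _ (fun d _ => Set.indicator_nonneg (fun _ _ => abs_nonneg _) _) h'
  refine hle.trans ?_
  -- `∏ (1 + a_p) ≤ exp(∑ a_p) ≤ exp 8`
  calc ∏ p ∈ N.primesBelow, ∑' e : ℕ, |lnu (p ^ e)| = ∏ p ∈ N.primesBelow, (1 + (|lnu p| + |lnu (p ^ 2)|)) := by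
        refine Finset.prod_congr rfl fun p hp => ?_
        rw [tsum_abs_lnu_prime_pow (Nat.prime_of_mem_primesBelow hp), add_assoc]
    _ ≤ ∏ p ∈ N.primesBelow, Real.exp (|lnu p| + |lnu (p ^ 2)|) := by
        refine Finset.prod_le_prod (fun p _ => by positivity) fun p _ => ?_
        have := Real.add_one_le_exp (|lnu p| + |lnu (p ^ 2)|); linarith
    _ = Real.exp (∑ p ∈ N.primesBelow, (|lnu p| + |lnu (p ^ 2)|)) := by rw [Real.exp_sum]
    _ ≤ Real.exp 8 := Real.exp_le_exp.mpr (sum_primesBelow_abs_lnu_le N)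

/-- **`∑_d |l(d)ν(d)/d| < ∞`** ("the infinite sum is absolutely convergent", p. 29).
[cite: HeathBrown2001LargestPrimeFactorCubic, p. 29] -/
theorem summable_abs_lnu : Summable fun d : ℕ => |lnu d| :=
  summable_of_sum_range_le (fun _ => abs_nonneg _) sum_range_abs_lnu_le

/-- Hence `lnu` is summable with summable norm. [folklore] -/
theorem summable_norm_lnu : Summable fun d : ℕ => ‖lnu d‖ := by
  simpa only [Real.norm_eq_abs] using summable_abs_lnu

/-! ### The value of the series -/

/-- **`∑_d l(d)ν(d)/d = P/(2 Rinf)`**, where `∏_{5≤p≤N} k(p) → P ≥ 0.917` (`…KProduct`) and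
`∏_{p<N} r(p) → Rinf` (`…MertensG`): the Euler product of the absolutely convergent series is
`lim ∏_{p<N} c(p)` (`…EulerIdentity.tendsto_cProd`).
[cite: HeathBrown2001LargestPrimeFactorCubic, p. 11 (C₁ and "C₂C₃ = (log 2)(log 4/3)/(3π²) ∏ k(p)")] -/
theorem tsum_lnu_eq : ∃ P : ℝ, (917 / 1000 : ℝ) ≤ P ∧ Tendsto kProd atTop (𝓝 P) ∧
    ∑' d : ℕ, lnu d = P / (2 * Rinf) := by
  obtain ⟨P, hP, hk, hc⟩ := tendsto_cProd
  refine ⟨P, hP, hk, ?_⟩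
  have hmul : ∀ {m n : ℕ}, Nat.Coprime m n → lnu (m * n) = lnu m * lnu n :=
    fun hmn => isMultiplicative_lnu.map_mul_of_coprime hmn
  have h := EulerProduct.eulerProduct (f := fun d : ℕ => lnu d) lnu_one hmul summable_norm_lnu (by simp)
  have heq : (fun n : ℕ => ∏ p ∈ Nat.primesBelow n, ∑' e : ℕ, lnu (p ^ e)) = cProd := by
    funext n
    rw [cProd]
    exact Finset.prod_congr rfl fun p hp => tsum_lnu_prime_pow (Nat.prime_of_mem_primesBelow hp)
  rw [heq] at h
  exact tendsto_nhds_unique h hc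

end Literature.NumberTheory.Sieve.HeathBrown2001
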